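import Summits.QuantumFields.BalabanUV.T4Continuum.Support.NE9Lemma1Gain

/-!
# NE9Lemma1PieceClass — leaf S5 for the CLASS-RELATIVE piece form: pieces additive and bounded ON THE ADMISSIBLE CLASS only,
# the per-piece bound asked under EXACTLY the family-level hypothesis of `ChannelSizeAtStepNN` (LOCATED CORRECTION of the
# gen-23 binders `PieceBound`/`PieceBoundG`, which are class-free and therefore undischargeable for the displayed species)
# (cell `pub-balaban`, T4-DAG §2 node U3 / §6 NE9; lineage t4-ne9-p1 = row NE9 OWNER, generation 24; part 1 of 2)

HONEST FRAMING (T4-DAG PAGE 1).  Rung (B)+1 of the FINITE-VOLUME T⁴ programme — NOT infinite volume, NOT a mass gap, NOT the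
Clay problem.  NE9 (`T4OutputRate.NE9` ∧ `FadingMemory`) is a cell NEW ESTIMATE, NOT PRINTED, NOT discharged here; spine 0/9.
HONEST DEPENDENCY (cell line, verbatim): continuum YM on T⁴ ⇐ BetaPertH ∧ nine spine estimates (0/9 proved); BetaPertH ⇐ (D1)
∧ (D4) ∧ CAP+tail; G-an2-4 gates asym, D1 and NE2/3/4.  `FlowStep.BetaPertH`, (B), (B^μ) do not occur.  [I] = [Balaban1987RG1]
(CMP **109**), [II] = [Balaban1988RG2Cluster] (CMP **116**) are quoted for TYPES only (ABSOLUTE RULE: nothing printed in the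
audited series is asserted).

THE LOCATED DEFECT (cell GAPS O-ne9p1g24-1, this lineage's own gen-23 binders).  `NE9Lemma1Counting.PieceBound` and
`NE9Lemma1Gain.PieceBoundG` ask, for EVERY function `f : Bg → ℝ` with `|f| ≤ e^{−κd_j(X)}·N`, that `|piece f| ≤ Kp·N·gain·…`
— i.e. that the piece, an additive functional on ALL bounded functions of the background, have OPERATOR size `≲ gain =
(L^jη)^{4+α}`.  For the displayed species this is false: the (L^jη)⁵ of [II] (1.24) p. 7 is [I] (3.54) p. 280, the FIFTH-ORDER
TAYLOR REMAINDER of an old term ANALYTIC on the complex space 𝔘^c_j(X, α₀, α₁) and bounded THERE ((1.18) p. 263); a merely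
bounded input has no remainder gain — kernel witness `not_pieceBoundG_of_evalDiff` (§4: an evaluation-difference piece, the
building block of (1.23), violates every class-free bound with `Kp·gain·(weights) < 2`), in line with `NE9RealSupNoGo` one
level up.  Moreover `PieceData.piece : (Bg → ℝ) →+ ℝ` (additive on ALL functions) cannot host a contour-integral /
Taylor-remainder functional (integrability; derivatives of non-differentiable slices).  Nothing LANDED is false — the gen-23
theorems are correct implications — but their hypothesis is not the printed per-piece statement; THIS FILE restates the form.

CONTENT (kernel, 0 sorry).  §1 `CPieceData`: the index families of `PieceData` and pieces that are PLAIN functionals of the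
input FAMILY `H : Bg → C.Dom → ℝ`, read (binder `PieceLocal`) only on the creation-step slice of their source — so a piece
sourced at the `re`-copy of X may read the `im`-copy too (`NE9ComplexEncoding.doubleCarriers`); binders `PieceZero`,
`PieceAdditiveOn Adm` (linearity of (1.23) in the old term ON THE CLASS), `CSrcScale`; channel `cpieceChannel`; structure
binders `ChannelAdditive Adm` (⇐ `PieceAdditiveOn Adm`), `ChannelLocal`, `ChannelStepSum` (any class) PROVED.  §2
**`PieceBoundOnG Adm`** — the per-piece (1.24)×(1.25) bound asked for `H ∈ Adm` under the scale-j family bound `∀ U X′, scale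
X′ = j → |H U X′| ≤ e^{−κd(X′)}·N` (VERBATIM the hypothesis of `ChannelSizeAtStepNN`) — and **`channelSizeAtStepNN_cpieceG`**:
S5 ON `Adm` from it + the level counts (`NE9Lemma1Gain.levels_boundG` BY NAME on the index frame `CPieceData.frame`); packaged
with the α-profile and with all four S-binders (`sBinders_cpieceG`).  §3 EMBEDDING of the gen-23 form (`toC`;
`cpieceChannel (toC P) = pieceChannel P`; `PieceBoundG P ⇒ PieceBoundOnG Adm (toC P)` for every `Adm`; the gen-23 leaf
`channelSizeAtStepNN_pieceG` re-derived as an `example` — every consumer keeps its statement).  §4 the WITNESS.  Part 2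
(`NE9Lemma1RemainderSpecies`) inhabits §1–§2 with the DISPLAYED species on the ANALYTIC class (re/im encoding) and PROVES
`PieceBoundOnG` there from `NE9Lemma1RemainderPiece.norm_remPiece_le`.

DISGUISE TEST: every statement concerns ONE input family and ONE history; S5 is the fading SOURCE, not NE9.
References (TYPES only): [Balaban1988RG2Cluster] T. Bałaban, CMP **116** (1988) 1–22, (1.23)–(1.29) pp. 7–8, (1.33)–(1.36)
p. 9; [Balaban1987RG1] T. Bałaban, CMP **109** (1987) 249–301, (0.23) p. 256, (1.18) p. 263, (3.54) p. 280.  Summits-side NEW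
work (LEAN PLACEMENT RULE); imports part `NE9Lemma1Gain` (hence `NE9Lemma1Counting`, `T4HistoryLipschitzRecursion`); modifies
nothing; 0 sorry.  Value = the S5 form-level leaf restated with the honest (class-relative) quantifier, NOT summit progress.
-/

noncomputable section

namespace Summit.QuantumFields.BalabanUV.T4Continuum.NE9Lemma1PieceClass

open scoped BigOperators
open Literature.MathematicalPhysics.QuantumFieldTheory.Balaban1983to89
open Literature.MathematicalPhysics.QuantumFieldTheory.Balaban1983to89.T4OutputRate
open Literature.MathematicalPhysics.QuantumFieldTheory.Balaban1983to89.T4HistoryLipschitzRecursion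
open Summit.QuantumFields.BalabanUV.T4Continuum.NE9Lemma1Counting
open Summit.QuantumFields.BalabanUV.T4Continuum.NE9Lemma1Gain

variable {C : Carriers} {Bg ι α β γ : Type}

/-! ## §1 The class-relative piece form and its structure binders -/

/-- **CLASS-RELATIVE PIECE DATA** of a channel of the printed (1.23)/(1.33)-form: the index families of
`NE9Lemma1Counting.PieceData` and, for (k, s, y, □₀, Y₀, X), the piece as a PLAIN functional of the input family `H` — in print
the contour integral (1.23) p. 7 of the old term created at step j evaluated at parameter-dependent configurations; linearity
and the bound are asked ON A CLASS (§1–§2 binders), not for all functions. [cite: Balaban1988RG2Cluster, (1.23) p.7, (1.33) p.9] -/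
structure CPieceData (C : Carriers) (Bg ι α β γ : Type) where
  /-- boxes □₀ ⊂ Y -/
  S0 : ℕ → ι → Finset α
  /-- connected domains Y₀ ∋ □̃⁴, given □₀ -/
  SY : ℕ → ι → α → Finset β
  /-- source domains X ∈ 𝐃_j of the pieces, given □₀ and the creation step j -/
  src : ℕ → ι → α → ℕ → Finset C.Dom
  /-- counting cubes □′ ∈ π_j, □′ ⊂ □̃² -/
  Sq : ℕ → ι → α → ℕ → Finset γ
  /-- the fibre X ∈ 𝐃_j, X ⊃ □′ -/
  SX : ℕ → ι → α → ℕ → γ → Finset C.Dom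
  /-- M⁻⁴|Y₀∖□̃⁴| -/
  vol : ℕ → ι → α → β → ℝ
  /-- d_k(Y) of the output index -/
  dY : ℕ → ι → ℝ
  /-- the localized piece sourced at X: a functional of the input family -/
  piece : ℕ → (ℕ → ℝ) → ι → α → β → C.Dom → (Bg → C.Dom → ℝ) → ℝ

/-- The INDEX FRAME of a class-relative piece datum: the same index families with the zero piece, an
`NE9Lemma1Counting.PieceData` — so that the level counts `LevelCounts(G)` and the gathering `levels_bound(G)` of parts 2/4 apply
BY NAME (they never read the piece). [folklore] -/
def CPieceData.frame (P : CPieceData C Bg ι α β γ) : PieceData C Bg ι α β γ where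
  S0 := P.S0
  SY := P.SY
  src := P.src
  Sq := P.Sq
  SX := P.SX
  vol := P.vol
  dY := P.dY
  piece := fun _ _ _ _ _ _ => 0

/-- **THE CHANNEL OF THE CLASS-RELATIVE PIECE FORM**: `T k s H y = Σ_{j≤k} Σ_{□₀} Σ_{Y₀} Σ_{X ∈ src} piece(k,s,y,□₀,Y₀,X)(H)` —
(1.33) p. 9 as the sum of the pieces (1.23) over *"all admissible □₀, Y₀, j and X"* (p. 7). [cite: Balaban1988RG2Cluster, (1.33) p.9] -/
def cpieceChannel (P : CPieceData C Bg ι α β γ) : ℕ → (ℕ → ℝ) → (Bg → C.Dom → ℝ) → ι → ℝ :=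
  fun k s H y => ∑ j ∈ Finset.range (k + 1), ∑ a ∈ P.S0 k y, ∑ b ∈ P.SY k y a, ∑ x ∈ P.src k y a j, P.piece k s y a b x H

/-- The one-creation-step block: the pieces with sources of creation step `j`. [folklore] -/
def cstepBlock (P : CPieceData C Bg ι α β γ) (k : ℕ) (s : ℕ → ℝ) (H : Bg → C.Dom → ℝ) (y : ι) (j : ℕ) : ℝ :=
  ∑ a ∈ P.S0 k y, ∑ b ∈ P.SY k y a, ∑ x ∈ P.src k y a j, P.piece k s y a b x H

/-- The channel is the sum of its one-step blocks over `j ≤ k`. [folklore] -/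
theorem cpieceChannel_eq_sum_cstepBlock (P : CPieceData C Bg ι α β γ) (k : ℕ) (s : ℕ → ℝ) (H : Bg → C.Dom → ℝ) (y : ι) :
    cpieceChannel P k s H y = ∑ j ∈ Finset.range (k + 1), cstepBlock P k s H y j := rfl

/-- BINDER: every piece vanishes on the zero family. [folklore] -/
def PieceZero (P : CPieceData C Bg ι α β γ) : Prop :=
  ∀ (k : ℕ) (s : ℕ → ℝ) (y : ι) (a : α) (b : β) (x : C.Dom), P.piece k s y a b x 0 = 0

/-- BINDER (printed structure, [I] (0.23) p. 256 / [II] (1.23) p. 7: the piece sourced at X ∈ 𝐃_j is built from the old term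
created at step j): the piece sourced at `x` reads the input family ONLY on the creation-step slice of `x` (with the re/im
doubling of `NE9ComplexEncoding` both copies of X lie in that slice). [cite: Balaban1988RG2Cluster, (1.23) p.7] -/
def PieceLocal (P : CPieceData C Bg ι α β γ) : Prop :=
  ∀ (k : ℕ) (s : ℕ → ℝ) (y : ι) (a : α) (b : β) (x : C.Dom) (H H' : Bg → C.Dom → ℝ),
    (∀ (U : Bg) (X : C.Dom), C.scale X = C.scale x → H U X = H' U X) → P.piece k s y a b x H = P.piece k s y a b x H'

/-- BINDER (printed structure: (1.23) p. 7 is LINEAR in the old term — a contour integral of its evaluations): the pieces are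
additive ON THE ADMISSIBLE CLASS (where the contour integrands are integrable). [cite: Balaban1988RG2Cluster, (1.23) p.7] -/
def PieceAdditiveOn (Adm : Set (Bg → C.Dom → ℝ)) (P : CPieceData C Bg ι α β γ) : Prop :=
  ∀ (k : ℕ) (s : ℕ → ℝ) (y : ι) (a : α) (b : β) (x : C.Dom), ∀ H₁ ∈ Adm, ∀ H₂ ∈ Adm,
    P.piece k s y a b x (H₁ - H₂) = P.piece k s y a b x H₁ - P.piece k s y a b x H₂

/-- SOURCE DISCIPLINE: the sources listed under the creation step `j` ARE domains of creation step `j`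
(= `NE9Lemma1Counting.SrcScale P.frame`). [cite: Balaban1988RG2Cluster, (1.23) p.7] -/
def CSrcScale (P : CPieceData C Bg ι α β γ) : Prop :=
  ∀ (k : ℕ) (y : ι) (a : α) (j : ℕ), ∀ x ∈ P.src k y a j, C.scale x = j

/-- **`ChannelAdditive Adm` FOR THE CLASS-RELATIVE PIECE FORM** from `PieceAdditiveOn Adm` (finite sums). [folklore] -/
theorem channelAdditive_cpiece {P : CPieceData C Bg ι α β γ} {Adm : Set (Bg → C.Dom → ℝ)} (hA : PieceAdditiveOn Adm P) :
    ChannelAdditive Adm (cpieceChannel P) := by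
  intro k s H₁ h₁ H₂ h₂ y
  simp only [cpieceChannel]
  rw [← Finset.sum_sub_distrib]
  refine Finset.sum_congr rfl fun j _ => ?_
  rw [← Finset.sum_sub_distrib]
  refine Finset.sum_congr rfl fun a _ => ?_
  rw [← Finset.sum_sub_distrib]
  refine Finset.sum_congr rfl fun b _ => ?_
  rw [← Finset.sum_sub_distrib]
  exact Finset.sum_congr rfl fun x _ => hA k s y a b x H₁ h₁ H₂ h₂

/-- On a block of creation step `j`, restricting the input family to the creation step `j′` keeps the block if `j = j′` and
kills it otherwise (locality + zero + source discipline). [folklore] -/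
theorem cstepBlock_restrictScale {P : CPieceData C Bg ι α β γ} (h0 : PieceZero P) (hloc : PieceLocal P)
    (hsrc : CSrcScale P) (k : ℕ) (s : ℕ → ℝ) (H : Bg → C.Dom → ℝ) (y : ι) (j j' : ℕ) :
    cstepBlock P k s (restrictScale j' H) y j = if j = j' then cstepBlock P k s H y j else 0 := by
  by_cases hjj : j = j'
  · rw [if_pos hjj]
    simp only [cstepBlock]
    refine Finset.sum_congr rfl fun a _ => Finset.sum_congr rfl fun b _ => Finset.sum_congr rfl fun x hx => ?_
    refine hloc k s y a b x _ _ fun U X hX => ?_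
    exact restrictScale_of_eq H (hX.trans ((hsrc k y a j x hx).trans hjj))
  · rw [if_neg hjj]
    simp only [cstepBlock]
    refine Finset.sum_eq_zero fun a _ => Finset.sum_eq_zero fun b _ => Finset.sum_eq_zero fun x hx => ?_
    have hx' : C.scale x ≠ j' := fun h => hjj ((hsrc k y a j x hx).symm.trans h)
    rw [hloc k s y a b x (restrictScale j' H) 0 fun U X hX => ?_]
    · exact h0 k s y a b x
    · exact restrictScale_of_ne H (fun h => hx' (hX.symm.trans h))

/-- The channel applied to the one-step restriction `restrictScale j′ H` is the block of creation step `j′` (zero if `j′ > k`).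
[folklore] -/
theorem cpieceChannel_restrictScale {P : CPieceData C Bg ι α β γ} (h0 : PieceZero P) (hloc : PieceLocal P)
    (hsrc : CSrcScale P) (k : ℕ) (s : ℕ → ℝ) (H : Bg → C.Dom → ℝ) (y : ι) (j' : ℕ) :
    cpieceChannel P k s (restrictScale j' H) y = if j' ∈ Finset.range (k + 1) then cstepBlock P k s H y j' else 0 := by
  rw [cpieceChannel_eq_sum_cstepBlock]
  simp_rw [cstepBlock_restrictScale h0 hloc hsrc]
  rw [Finset.sum_ite_eq']

/-- **`ChannelStepSum` FOR THE CLASS-RELATIVE PIECE FORM, on ANY class** ((1.33) p. 9 sums the pieces (1.23) over j).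
[cite: Balaban1988RG2Cluster, (1.33) p.9] -/
theorem channelStepSum_cpiece {P : CPieceData C Bg ι α β γ} (h0 : PieceZero P) (hloc : PieceLocal P)
    (hsrc : CSrcScale P) (Adm : Set (Bg → C.Dom → ℝ)) : ChannelStepSum Adm (cpieceChannel P) := by
  intro k s H _ y
  rw [cpieceChannel_eq_sum_cstepBlock]
  refine Finset.sum_congr rfl fun j hj => ?_
  rw [cpieceChannel_restrictScale h0 hloc hsrc, if_pos hj]

/-- **`ChannelLocal` FOR THE CLASS-RELATIVE PIECE FORM, on ANY class** (the step-k channel reads only the creation steps ≤ k,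
[I] (0.23) p. 256). [cite: Balaban1987RG1, (0.23) p.256] -/
theorem channelLocal_cpiece {P : CPieceData C Bg ι α β γ} (hloc : PieceLocal P) (hsrc : CSrcScale P)
    (Adm : Set (Bg → C.Dom → ℝ)) : ChannelLocal Adm (cpieceChannel P) := by
  intro k s H _ y
  simp only [cpieceChannel]
  refine Finset.sum_congr rfl fun j hj => Finset.sum_congr rfl fun a _ => Finset.sum_congr rfl fun b _ =>
    Finset.sum_congr rfl fun x hx => ?_
  refine hloc k s y a b x _ _ fun U X hX => ?_
  have hXk : C.scale X ≤ k := by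
    rw [hX, hsrc k y a j x hx]; exact Nat.lt_succ_iff.mp (Finset.mem_range.mp hj)
  simp only [truncScale, if_pos hXk]

/-- For an input family SUPPORTED at the creation step `j ≤ k`, the channel output IS the step-j block. [folklore] -/
theorem cpieceChannel_of_supported {P : CPieceData C Bg ι α β γ} (h0 : PieceZero P) (hloc : PieceLocal P)
    (hsrc : CSrcScale P) {k j : ℕ} (hjk : j ≤ k) (s : ℕ → ℝ) {H : Bg → C.Dom → ℝ}
    (hsupp : ∀ (U : Bg) (X : C.Dom), C.scale X ≠ j → H U X = 0) (y : ι) :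
    cpieceChannel P k s H y = cstepBlock P k s H y j := by
  have hH : restrictScale j H = H := by
    funext U X
    by_cases h : C.scale X = j
    · exact restrictScale_of_eq H h
    · rw [restrictScale_of_ne H h, hsupp U X h]
  have h1 := cpieceChannel_restrictScale h0 hloc hsrc k s H y j
  rw [hH, if_pos (Finset.mem_range.mpr (Nat.lt_succ_of_le hjk))] at h1
  exact h1

/-! ## §2 The class-relative per-piece bound and leaf S5 from it -/

/-- **THE PER-PIECE BOUND (1.24)×(1.25), CLASS-RELATIVE, GENERAL GAIN** (binder; PROOF-INTERIOR of [I] §§3–5: (I.3.54) for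
the displayed family — PROVED on the analytic class in part 2 —, (I.4.5), (I.4.22), (I.4.36), (I.5.44) for the others by the
printed analogy [II] p. 8 ¶2): for an ADMISSIBLE family `H ∈ Adm` whose creation-step-j slice is bounded by `e^{−κd(X′)}·N`
(VERBATIM the hypothesis of `ChannelSizeAtStepNN`), the piece sourced at `x` (step j) is bounded by `Kp k y · N · gain k j ·
e^{−κd(x)} · exp(−⅛(κ₁−1)d_k(Y) + ⅛κ₁d₀ − ½(κ₁−1)·vol)` — (1.24) p. 7 with (1.25), LINEAR in N, `gain = (L^jη)^{4+α}` ([I]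
(0.29) p. 258).  CAVEAT (GAPS O-ne9p1g22-1): the class must be marginal-free. [cite: Balaban1988RG2Cluster, (1.24)-(1.25) p.7] -/
def PieceBoundOnG (Adm : Set (Bg → C.Dom → ℝ)) (P : CPieceData C Bg ι α β γ) (κ κ₁ d0 : ℝ) (Kp : ℕ → ι → ℝ)
    (gain : ℕ → ℕ → ℝ) : Prop :=
  ∀ (k : ℕ) (s : ℕ → ℝ) (y : ι), ∀ a ∈ P.S0 k y, ∀ b ∈ P.SY k y a, ∀ (j : ℕ), ∀ x ∈ P.src k y a j,
    ∀ H ∈ Adm, ∀ (N : ℝ), 0 ≤ N →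
      (∀ (U : Bg) (X : C.Dom), C.scale X = j → |H U X| ≤ Real.exp (-(κ * C.d X)) * N) →
        |P.piece k s y a b x H| ≤ Kp k y * N * gain k j * Real.exp (-(κ * C.d x)) *
          Real.exp (-(1 / 8) * (κ₁ - 1) * P.dY k y + (1 / 8) * κ₁ * d0 - (1 / 2) * (κ₁ - 1) * P.vol k y a b)

/-- The step-j block of an admissible family of size `N·e^{−κd}` at scale j is bounded by `weightOf · (tauOfG · N)` —
`NE9Lemma1Gain.levels_boundG` applied on the index frame to the absolute values of the pieces. [folklore] -/
theorem abs_cstepBlock_le {P : CPieceData C Bg ι α β γ} {Adm : Set (Bg → C.Dom → ℝ)} {κ κ₁ d0 O1 cQ : ℝ}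
    {Kp : ℕ → ι → ℝ} {gain ℓ : ℕ → ℕ → ℝ} (hPiece : PieceBoundOnG Adm P κ κ₁ d0 Kp gain)
    (hL : LevelCountsG P.frame κ κ₁ O1 cQ gain ℓ) (hKp : ∀ k y, 0 ≤ Kp k y) (hO1 : 0 ≤ O1)
    (hgain : ∀ k j, 0 ≤ gain k j) (hcQℓ : ∀ k j, 0 ≤ cQ * ℓ k j) (k j : ℕ) (s : ℕ → ℝ) (y : ι)
    {H : Bg → C.Dom → ℝ} (hH : H ∈ Adm) {N : ℝ} (hN : 0 ≤ N)
    (hbd : ∀ (U : Bg) (X : C.Dom), C.scale X = j → |H U X| ≤ Real.exp (-(κ * C.d X)) * N) :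
    |cstepBlock P k s H y j| ≤ weightOf P.frame κ₁ d0 O1 Kp k y * (tauOfG cQ ℓ k j * N) := by
  have h1 : |cstepBlock P k s H y j| ≤ ∑ a ∈ P.S0 k y, ∑ b ∈ P.SY k y a,
      ∑ x ∈ P.src k y a j, |P.piece k s y a b x H| := by
    simp only [cstepBlock]
    refine (Finset.abs_sum_le_sum_abs _ _).trans (Finset.sum_le_sum fun a _ => ?_)
    refine (Finset.abs_sum_le_sum_abs _ _).trans (Finset.sum_le_sum fun b _ => ?_)
    exact Finset.abs_sum_le_sum_abs _ _
  have h2 := levels_boundG P.frame hL (mul_nonneg (hKp k y) hN) hO1 hgain hcQℓ k y j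
    (fun a b x => |P.piece k s y a b x H|) (fun a _ b _ x _ => abs_nonneg _)
    (fun a ha b hb x hx => hPiece k s y a ha b hb j x hx H hH N hN hbd)
  calc |cstepBlock P k s H y j| ≤ _ := h1
    _ ≤ Kp k y * N * O1 * (cQ * ℓ k j) * Real.exp 1 * Real.exp ((1 / 8) * κ₁ * d0) *
          Real.exp (-(1 / 16) * κ₁ * P.frame.dY k y) := h2
    _ = weightOf P.frame κ₁ d0 O1 Kp k y * (tauOfG cQ ℓ k j * N) := by
        simp only [weightOf, tauOfG]; ring

/-- **LEAF S5 FOR THE CLASS-RELATIVE PIECE FORM (the point of the module)**: `ChannelSizeAtStepNN Adm (cpieceChannel P) κ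
(weightOf P.frame κ₁ d₀ O1 Kp) (tauOfG c_Q ℓ)` ON THE CLASS `Adm` from `PieceBoundOnG Adm`, zero/locality/source discipline,
and the level counts of [II] p. 8 on the index frame; print's letters: gain = (L^jη)^{4+α}, c_Q = (6L)⁴, ℓ = (L^jη)^α, α of [I]
(0.29) (rate letter ω = L^{−α}, GAPS O-ne9p1g23-1). [cite: Balaban1988RG2Cluster, (1.24)-(1.29) pp.7-8, (1.36) p.9] -/
theorem channelSizeAtStepNN_cpieceG {P : CPieceData C Bg ι α β γ} {Adm : Set (Bg → C.Dom → ℝ)} {κ κ₁ d0 O1 cQ : ℝ}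
    {Kp : ℕ → ι → ℝ} {gain ℓ : ℕ → ℕ → ℝ} (h0 : PieceZero P) (hloc : PieceLocal P) (hsrc : CSrcScale P)
    (hPiece : PieceBoundOnG Adm P κ κ₁ d0 Kp gain) (hL : LevelCountsG P.frame κ κ₁ O1 cQ gain ℓ)
    (hKp : ∀ k y, 0 ≤ Kp k y) (hO1 : 0 ≤ O1) (hgain : ∀ k j, 0 ≤ gain k j) (hcQℓ : ∀ k j, 0 ≤ cQ * ℓ k j) :
    ChannelSizeAtStepNN Adm (cpieceChannel P) κ (weightOf P.frame κ₁ d0 O1 Kp) (tauOfG cQ ℓ) := by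
  intro k j hjk s H hH hsupp N hN hbd y
  rw [cpieceChannel_of_supported h0 hloc hsrc hjk s hsupp y]
  exact abs_cstepBlock_le hPiece hL hKp hO1 hgain hcQℓ k j s y hH hN hbd

/-- THE FOUR S-BINDERS OF THE NE9 END AT ONCE for the class-relative piece form on the class `Adm`: `ChannelAdditive`
(⇐ `PieceAdditiveOn Adm`), `ChannelLocal`, `ChannelStepSum`, `ChannelSizeAtStepNN` (⇐ `PieceBoundOnG Adm` + counts); the
profile binders `hτ`/`hω`/`hτbar` for `ℓ = agePow ω` are `NE9Lemma1Gain.profileG` (ω := L^{−α}, `rpow_neg_pos_lt_one`). [folklore] -/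
theorem sBinders_cpieceG {P : CPieceData C Bg ι α β γ} {Adm : Set (Bg → C.Dom → ℝ)} {κ κ₁ d0 O1 cQ : ℝ}
    {Kp : ℕ → ι → ℝ} {gain ℓ : ℕ → ℕ → ℝ} (h0 : PieceZero P) (hloc : PieceLocal P) (hsrc : CSrcScale P)
    (hA : PieceAdditiveOn Adm P) (hPiece : PieceBoundOnG Adm P κ κ₁ d0 Kp gain)
    (hL : LevelCountsG P.frame κ κ₁ O1 cQ gain ℓ) (hKp : ∀ k y, 0 ≤ Kp k y) (hO1 : 0 ≤ O1)
    (hgain : ∀ k j, 0 ≤ gain k j) (hcQℓ : ∀ k j, 0 ≤ cQ * ℓ k j) :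
    ChannelAdditive Adm (cpieceChannel P) ∧ ChannelLocal Adm (cpieceChannel P) ∧ ChannelStepSum Adm (cpieceChannel P) ∧
      ChannelSizeAtStepNN Adm (cpieceChannel P) κ (weightOf P.frame κ₁ d0 O1 Kp) (tauOfG cQ ℓ) :=
  ⟨channelAdditive_cpiece hA, channelLocal_cpiece hloc hsrc Adm, channelStepSum_cpiece h0 hloc hsrc Adm,
    channelSizeAtStepNN_cpieceG h0 hloc hsrc hPiece hL hKp hO1 hgain hcQℓ⟩

/-! ## §3 Embedding of the gen-23 (→+, class-free) piece form -/

/-- The gen-23 piece datum as a class-relative one: the piece sourced at `x` reads the family at `x` through its additive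
functional. [folklore] -/
def toC (P : PieceData C Bg ι α β γ) : CPieceData C Bg ι α β γ where
  S0 := P.S0
  SY := P.SY
  src := P.src
  Sq := P.Sq
  SX := P.SX
  vol := P.vol
  dY := P.dY
  piece := fun k s y a b x H => P.piece k s y a b x (fun U => H U x)

/-- The two channels coincide. [folklore] -/
theorem cpieceChannel_toC (P : PieceData C Bg ι α β γ) : cpieceChannel (toC P) = pieceChannel P := rfl

/-- `PieceZero` is automatic for the embedded form (`map_zero`). [folklore] -/
theorem pieceZero_toC (P : PieceData C Bg ι α β γ) : PieceZero (toC P) := by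
  intro k s y a b x
  show P.piece k s y a b x (fun U => (0 : Bg → C.Dom → ℝ) U x) = 0
  have h : (fun U => (0 : Bg → C.Dom → ℝ) U x) = 0 := by funext U; rfl
  rw [h, map_zero]

/-- `PieceLocal` is automatic for the embedded form (the piece reads the family at its own source only). [folklore] -/
theorem pieceLocal_toC (P : PieceData C Bg ι α β γ) : PieceLocal (toC P) := by
  intro k s y a b x H H' hHH'
  show P.piece k s y a b x (fun U => H U x) = P.piece k s y a b x (fun U => H' U x)
  have h : (fun U => H U x) = fun U => H' U x := by funext U; exact hHH' U x rfl
  rw [h]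

/-- `PieceAdditiveOn Adm` is automatic for the embedded form, on every class (`map_sub`). [folklore] -/
theorem pieceAdditiveOn_toC (P : PieceData C Bg ι α β γ) (Adm : Set (Bg → C.Dom → ℝ)) : PieceAdditiveOn Adm (toC P) := by
  intro k s y a b x H₁ _ H₂ _
  show P.piece k s y a b x (fun U => (H₁ - H₂) U x) = P.piece k s y a b x (fun U => H₁ U x) - P.piece k s y a b x (fun U => H₂ U x)
  have h : (fun U => (H₁ - H₂) U x) = (fun U => H₁ U x) - fun U => H₂ U x := by funext U; simp only [Pi.sub_apply]
  rw [h, map_sub]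

/-- The level counts transfer to the index frame of the embedded form (same index families; likewise `CSrcScale (toC P) ↔
SrcScale P` and `weightOf (toC P).frame = weightOf P` hold by `rfl`). [folklore] -/
theorem levelCountsG_toC {P : PieceData C Bg ι α β γ} {κ κ₁ O1 cQ : ℝ} {gain ℓ : ℕ → ℕ → ℝ}
    (h : LevelCountsG P κ κ₁ O1 cQ gain ℓ) : LevelCountsG (toC P).frame κ κ₁ O1 cQ gain ℓ :=
  ⟨h.cover, h.sumX, h.countQ, h.sumY, h.count0⟩

/-- **THE CLASS-FREE BINDER IMPLIES THE CLASS-RELATIVE ONE on every class** (it is asked for all bounded functions, in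
particular for `U ↦ H U x` under the scale-j family bound read at `x`, `scale x = j` by the source discipline). [folklore] -/
theorem pieceBoundOnG_toC_of_pieceBoundG {P : PieceData C Bg ι α β γ} {κ κ₁ d0 : ℝ} {Kp : ℕ → ι → ℝ}
    {gain : ℕ → ℕ → ℝ} (hsrc : SrcScale P) (h : PieceBoundG P κ κ₁ d0 Kp gain) (Adm : Set (Bg → C.Dom → ℝ)) :
    PieceBoundOnG Adm (toC P) κ κ₁ d0 Kp gain := by
  intro k s y a ha b hb j x hx H _ N hN hbd
  exact h k s y a ha b hb j x hx (fun U => H U x) N hN (fun U => hbd U x (hsrc k y a j x hx))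

/-- CONSISTENCY (an `example`, the statement being literally the landed `NE9Lemma1Gain.channelSizeAtStepNN_pieceG`): the gen-23
leaf re-derived through the class-relative route — every consumer of the gen-23 form keeps its statement. [folklore] -/
example {P : PieceData C Bg ι α β γ} {κ κ₁ d0 O1 cQ : ℝ} {Kp : ℕ → ι → ℝ}
    {gain ℓ : ℕ → ℕ → ℝ} (hsrc : SrcScale P) (hPiece : PieceBoundG P κ κ₁ d0 Kp gain)
    (hL : LevelCountsG P κ κ₁ O1 cQ gain ℓ) (hKp : ∀ k y, 0 ≤ Kp k y) (hO1 : 0 ≤ O1) (hgain : ∀ k j, 0 ≤ gain k j)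
    (hcQℓ : ∀ k j, 0 ≤ cQ * ℓ k j) (Adm : Set (Bg → C.Dom → ℝ)) :
    ChannelSizeAtStepNN Adm (pieceChannel P) κ (weightOf P κ₁ d0 O1 Kp) (tauOfG cQ ℓ) := by
  have hsrc' : CSrcScale (toC P) := hsrc
  have h := channelSizeAtStepNN_cpieceG (pieceZero_toC P) (pieceLocal_toC P) hsrc'
    (pieceBoundOnG_toC_of_pieceBoundG hsrc hPiece Adm) (levelCountsG_toC hL) hKp hO1 hgain hcQℓ
  rw [cpieceChannel_toC] at h
  exact h

/-! ## §4 WITNESS: the class-free binder forces operator smallness and fails for evaluation-type pieces -/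

/-- The EVALUATION-DIFFERENCE functional `f ↦ f(U₁) − f(U₀)` — additive on all functions; the building block of the (1.23)
contour integrand, and for an analytic input the FIRST-order remainder along U₁ − U₀ (`NE9Lemma1RemainderPiece.dirRem … 1`).
[folklore] -/
def evalDiff (U₁ U₀ : Bg) : (Bg → ℝ) →+ ℝ where
  toFun f := f U₁ - f U₀
  map_zero' := by simp
  map_add' f g := by simp only [Pi.add_apply]; ring

/-- On the two-valued bounded function `±N` the evaluation difference attains `2N` — no gain whatsoever from boundedness alone.
[folklore] -/
theorem evalDiff_twoValued [DecidableEq Bg] {U₁ U₀ : Bg} (hU : U₁ ≠ U₀) (N : ℝ) :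
    evalDiff U₁ U₀ (fun U => if U = U₁ then N else -N) = 2 * N := by
  show ((if U₁ = U₁ then N else -N) - if U₀ = U₁ then N else -N) = 2 * N
  rw [if_pos rfl, if_neg hU.symm]
  ring

/-- **THE CLASS-FREE PER-PIECE BINDER FAILS FOR EVALUATION-TYPE PIECES** (kernel form of GAPS O-ne9p1g24-1): if some listed
piece of a gen-23 piece datum IS an evaluation difference at two distinct configurations, then `PieceBoundG` forces
`Kp·gain·(the (1.25) weight) ≥ 2` there — a (1.24)-shaped bound with GAIN `(L^jη)^{4+α} → 0` is impossible for all bounded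
inputs; the gain needs analyticity on the complex domain (part 2).  Print's (1.24) is stated for the analytic old terms of
(1.18), not for all bounded functions — nothing printed is contradicted. [folklore] -/
theorem two_le_of_pieceBoundG_evalDiff [DecidableEq Bg] {P : PieceData C Bg ι α β γ} {κ κ₁ d0 : ℝ}
    {Kp : ℕ → ι → ℝ} {gain : ℕ → ℕ → ℝ} (h : PieceBoundG P κ κ₁ d0 Kp gain)
    {k : ℕ} {s : ℕ → ℝ} {y : ι} {a : α} (ha : a ∈ P.S0 k y) {b : β} (hb : b ∈ P.SY k y a) {j : ℕ} {x : C.Dom}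
    (hx : x ∈ P.src k y a j) {U₁ U₀ : Bg} (hU : U₁ ≠ U₀) (hpiece : P.piece k s y a b x = evalDiff U₁ U₀) :
    2 ≤ Kp k y * gain k j *
      Real.exp (-(1 / 8) * (κ₁ - 1) * P.dY k y + (1 / 8) * κ₁ * d0 - (1 / 2) * (κ₁ - 1) * P.vol k y a b) := by
  set w : ℝ := Real.exp (-(κ * C.d x)) with hw  -- test on the two-valued family `± e^{−κd(x)}` (size N = 1)
  have hwpos : 0 < w := Real.exp_pos _
  let f : Bg → ℝ := fun U => if U = U₁ then w else -w
  have hf : ∀ U : Bg, |f U| ≤ Real.exp (-(κ * C.d x)) * 1 := by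
    intro U
    simp only [f, mul_one]
    split_ifs
    · exact le_of_eq (abs_of_pos hwpos)
    · rw [abs_neg]; exact le_of_eq (abs_of_pos hwpos)
  have hval : P.piece k s y a b x f = 2 * w := by rw [hpiece]; exact evalDiff_twoValued hU w
  have hb' := h k s y a ha b hb j x hx f 1 zero_le_one hf
  rw [hval, abs_of_pos (by positivity)] at hb'
  have h2 : 2 * w ≤ Kp k y * gain k j * Real.exp (-(1 / 8) * (κ₁ - 1) * P.dY k y + (1 / 8) * κ₁ * d0 -
      (1 / 2) * (κ₁ - 1) * P.vol k y a b) * w := by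
    calc 2 * w ≤ _ := hb'
      _ = _ := by rw [hw]; ring
  exact le_of_mul_le_mul_right h2 hwpos

/-- Contrapositive: a class-free `PieceBoundG` with `Kp·gain·(weight) < 2` at an evaluation-difference piece is FALSE. [folklore] -/
theorem not_pieceBoundG_of_evalDiff [DecidableEq Bg] {P : PieceData C Bg ι α β γ} {κ κ₁ d0 : ℝ} {Kp : ℕ → ι → ℝ}
    {gain : ℕ → ℕ → ℝ} {k : ℕ} {s : ℕ → ℝ} {y : ι} {a : α} (ha : a ∈ P.S0 k y) {b : β} (hb : b ∈ P.SY k y a) {j : ℕ}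
    {x : C.Dom} (hx : x ∈ P.src k y a j) {U₁ U₀ : Bg} (hU : U₁ ≠ U₀) (hpiece : P.piece k s y a b x = evalDiff U₁ U₀)
    (hsmall : Kp k y * gain k j *
      Real.exp (-(1 / 8) * (κ₁ - 1) * P.dY k y + (1 / 8) * κ₁ * d0 - (1 / 2) * (κ₁ - 1) * P.vol k y a b) < 2) :
    ¬ PieceBoundG P κ κ₁ d0 Kp gain :=
  fun h => absurd (two_le_of_pieceBoundG_evalDiff h ha hb hx hU hpiece (s := s)) (not_le.mpr hsmall)

end Summit.QuantumFields.BalabanUV.T4Continuum.NE9Lemma1PieceClass
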